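import Literature.MathematicalPhysics.QuantumFieldTheory.Balaban1983to89.Node00.OpsYRecordV4P
import Literature.MathematicalPhysics.QuantumFieldTheory.Balaban1983to89.B9Thm39OneCubeReadingAtLettersY
import Literature.MathematicalPhysics.QuantumFieldTheory.Balaban1983to89.B9Thm39WholeBlkViaDatum
import Literature.MathematicalPhysics.QuantumFieldTheory.Balaban1983to89.B9RowSum261DefiniteFaces
import Literature.MathematicalPhysics.QuantumFieldTheory.Balaban1983to89.B9Thm311PosAtRecordV4
import Literature.MathematicalPhysics.QuantumFieldTheory.Balaban1983to89.B9Thm311ReadingAtLetters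
import Literature.MathematicalPhysics.QuantumFieldTheory.Balaban1983to89.B9Thm311Whole
import Literature.MathematicalPhysics.QuantumFieldTheory.Balaban1983to89.B9Thm312Whole
import Literature.MathematicalPhysics.QuantumFieldTheory.Balaban1983to89.B9RWSumsDefinitePinsPairMDir
import Literature.MathematicalPhysics.QuantumFieldTheory.Balaban1983to89.B9CoReadingCoordsTranspose
import Literature.MathematicalPhysics.QuantumFieldTheory.Balaban1983to89.B9CoReadingCoordsH
import Literature.MathematicalPhysics.QuantumFieldTheory.Balaban1983to89.B9GeoNbrCountKLevelV1
import Literature.MathematicalPhysics.QuantumFieldTheory.Balaban1983to89.B6Cover236MultiLevelBlocks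

/-!
# `Balaban1983to89.Node00.OpsYExpsOfRecord` — T. Bałaban, *Propagators for lattice gauge theories in a background field*, Commun. Math. Phys. **99**
# (1985) 389–434 [Balaban1985BackgroundPropagators], Thms 3.7–3.13 pp. 409–426: THE EXPANSION-LETTER RECORD `𝔈` OF STAGE 3′(Y) AS A FUNCTION OF THE
# N06 SEATS' DEFINITE READERS — `expsYOfRecordV1`, its faces at `opsYNuOfRecordV4PE ∕ opsYOfRecordV4PE`, and `pins_of_eq`

statement-level skeleton of published theorems with citation tags; proofs where landed; nothing here is a claim about the Yang–Mills mass gap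

THE PRINT.  p. 413 (Theorem 3.9): *«This theorem implies Theorem 3.2»*; p. 422: *«Of course Theorem 3.10 holds also because we replace each operator in
(3.130) by its random walk expansion»*; p. 423: *«Replacing the operators in (3.138) by their random walk expansions we get a random walk expansion for
G₁»*.  The expansions of Theorems 3.7 ∕ 3.9 ∕ 3.10 ((3.90) p. 409, (3.98)–(3.99) p. 413, (3.107)–(3.108) pp. 415–416), the positivity statements of
Theorem 3.11 (p. 416) and the perturbation series of Theorems 3.12 ∕ 3.13 (pp. 423, 426) are, in the N06 certificate, PREDICATE ∕ EXPANSION LETTERS of the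
operator layer: the fields `E37 ∕ EK39 ∕ E310 ∕ PosDef ∕ HasRWExp ∕ HasRWExpH ∕ PosDefK` of def-Y's `ExpLettersY` (`Node00.OpsYOfLetters`), carried by
the parameter `𝔈 : ExpsY N θ M⋆` of the instances of record `opsYOfRecordV4PE ∕ opsYNuOfRecordV4PE` (`Node00.OpsYRecordV4P`).

WHY THIS FILE (pub-ymgap bus 2026-08-28, node00-def-Y g24 INTENT-55; director-ym R168 row (2): def-Y owns the `OpsY` instance at the record and its
residual operator layer).  The stage-11 certificate (edition 41, `Summit.….N06AtOpsYNuOfRecordV6EPairNV`) elaborates against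
`opsYNuOfRecordV4PE N θ M⋆ 𝔯 (sectEYOfRecordV6 … 𝔢₀) 𝔴 𝔈` with `𝔈` FREE and DISPLAYS SEVEN PINS tying `𝔈`'s fields to the N06 seats' definite
readers: `hEK39` (dag-n06-g∕j: `EK39OfOpsBlkVia` of the one-cube letters `oneCubeOps39YF` on the faithful block map `bI`), `hPD` (dag-n06-j∕l:
`PosDefOfOps (ops311Y …)`), `hE37 ∕ hE310` (dag-n06-d∕w-seats: the definite `PairM` E-letters `E37YPairMDir ∕ E310YPairM` of the walk readers
`𝔬 𝔡 𝔩 rd ∕ 𝔬A rdA`), `hpinE ∕ hpinH ∕ hpinK` (dag-n06-k: `HasRWExpOfOps ∕ HasRWExpHOfOps ∕ PosDefKOfOps` of the Sect.-D letters `𝔬12`).  Every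
right-hand side is already a DEFINITION in the tree; what was missing is the record that HAS them as fields.  This file defines it, so that an edition
may replace the seven displayed pins by ONE equation `h𝔈 : 𝔈 = expsYOfRecordV1 …` (recovering the seven named hypotheses by `pins_of_eq`), or
instantiate `𝔈 := expsYOfRecordV1 …` outright (the seven pins then close by `rfl`), and so that the K1 closer has a canonical `𝔈` to supply.

WHAT THIS FILE DOES (definitions + `rfl` transport; record-level knit file — it imports the N06 seats' reader modules; nothing in NODE 00's letter
layer imports it):
* §1 ★★ `expsYOfRecordV1 N θ M⋆ 𝔯 𝔈₀ bI α′ r39 B39 p q p3 q3 pM qM H 𝔬 𝔡 𝔩 rd 𝔬A rdA 𝔬12 : ExpsY N θ M⋆` — the base record `𝔈₀` with the SEVEN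
  pinned fields REPLACED by the certificate's right-hand sides VERBATIM (the site ∕ bond kernel families fed to `E37YPairMDir ∕ E310YPairM` are the
  record's own `kernelFamilyS … (𝔏 x).Gp (𝔏 x).parS ∕ kernelFamilyB … (𝔏 x).GA (𝔏 x).parB`, `𝔏 := lettersYOfRecordV4P N θ M⋆ 𝔯` — the `rfl`-values
  of `(opsYNuOfRecordV4PE …).Gp ∕ .GA`); `IsAnalyticExt`, `GivenBy3185`, `HasRWExpC` are KEPT from `𝔈₀` (the analyticity predicate of row 13 is
  Sect.-B content, not a pin; the two Sect.-E predicates are read from `𝔢 ∕ 𝔴` at the v4P instances, `Node00.opsYNuOfRecordV4PE_sectE`); field lemmas.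
* §2 ★★ the SEVEN FACES at `opsYNuOfRecordV4PE N θ M⋆ 𝔯 𝔢 𝔴 (expsYOfRecordV1 …)` for ANY Sect.-E ∕ walk families `𝔢 𝔴` (so at
  `sectEYOfRecordV6 … 𝔢₀` by instantiation), each in EXACTLY the certificate's binder shape (`(OPS x).Gp ∕ (OPS x).GA` on the right of `E37 ∕ E310`),
  all `rfl`; the conjunction `pins`; ★★★ `pins_of_eq : 𝔈 = expsYOfRecordV1 … → ⟨hEK39, hPD, hE37, hE310, hpinE, hpinH, hpinK⟩`; the same at the plain
  instance `opsYOfRecordV4PE` (`pinsP`, `pinsP_of_eq`).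

HONEST SCOPE.  Definitional packaging of def-Y's own residual parameter and `rfl` transport; no inequality, expansion or positivity statement of the
paper is proved or asserted (the fields are PREDICATES whose truth the certificate's rows display as hypotheses); the walk readers `𝔬 𝔡 𝔩 rd 𝔬A rdA
𝔬12`, the block map `bI` and the numerics stay the certificate's binders.  Nothing landed is modified; N06 is NOT discharged; NOT continuum, NOT OS,
NOT the mass gap.  Filed by the pub-ymgap def-Y owner lineage (`pub-ymgap-node00-def-Y`, gen 24).  Net new unproved facts: 0.
-/

noncomputable section

namespace Literature.MathematicalPhysics.QuantumFieldTheory.Balaban1983to89.Node00.OpsYExpsOfRecord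

open Node00
open B9PinMembersKLevelV1 (MemberY geo9Y bg9Y)
open B7Prop2SpecialUnitary (specialUnitaryUnits)
open B6Cover236MultiLevelBlocks (cubes)
open B9Thm37Whole (Ops)
open B9Cor38Whole (WalkReading)
open B9RWSums346SecondDiffGp (DirOps37)
open B9Thm37WholeDir (DirLetters37)
open B9Thm310Whole (Ops310 WalkReading310)
open B9Thm311Whole (PosDefOfOps)
open B9Thm311ReadingAtLetters (ops311Y)
open B9Thm311PosAtRecordV4 (proofLettersGA)
open B9Thm39WholeBlkViaDatum (EK39OfOpsBlkVia)
open B9Thm39ReadingFaithful (repSite39F)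
open B9Thm39OneCubeReadingAtLettersY (oneCubeOps39YF oneCubeReading39)
open B9RowSum261DefiniteFaces (rowConst261)
open B9Thm312Whole (HasRWExpOfOps HasRWExpHOfOps PosDefKOfOps)
open B9RWSumsDefinitePins (PinPrims)
open B9RWSumsDefinitePinsPair (PairPrims)
open B9RWSumsDefinitePinsPairM (MixedPrims E310YPairM)
open B9RWSumsDefinitePinsPairMDir (E37YPairMDir)
open B9CoReadingCoordsTranspose (TrIdx)
open B9CoReadingCoords (XBK)
open B9CoReadingCoordsS (XSK)
open B9CoReadingCoordsH (XHK)
open B9GeoNbrCountKLevelV1 (nbrCountY)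
open scoped Matrix.Norms.L2Operator

/-! ## §1 ★★ The expansion-letter record of record -/

section Defn

/-- ★★ **THE EXPANSION LETTERS OF RECORD** `𝔈 := expsYOfRecordV1 N θ M⋆ 𝔯 𝔈₀ bI α′ r39 B39 p q p3 q3 pM qM H 𝔬 𝔡 𝔩 rd 𝔬A rdA 𝔬12`: the base record `𝔈₀`
with the seven fields the N06 certificate PINS replaced by its right-hand sides — Theorem 3.9's kernel expansion of `(Q′G′²Q′*)⁻¹` read blockwise off the
one-cube letters on the faithful block map (`EK39`), Theorem 3.11's five positivity statements at the letters (`PosDef`), the definite `PairM` E-letters of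
Theorems 3.7 ∕ 3.8 and 3.10 over the walk readers, fed the record's own site ∕ bond kernel families (`E37 ∕ E310`), and Theorems 3.12 ∕ 3.13's perturbation
series ∕ positivity over the Sect.-D letters `𝔬12` (`HasRWExp ∕ HasRWExpH ∕ PosDefK`); `IsAnalyticExt ∕ GivenBy3185 ∕ HasRWExpC` are `𝔈₀`'s.
[cite: Balaban1985BackgroundPropagators, Thm 3.7 (3.90) p.409 + Cor. 3.8 (3.93)–(3.94) p.410, Thm 3.9 (3.98)–(3.99) p.413, Thm 3.10 (3.107)–(3.108) pp.415–416,
Thm 3.11 p.416, Thm 3.12 p.423 + (3.130) p.421 + (3.138) p.423, Thm 3.13 p.426 + (3.147)–(3.148) p.425] -/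
def expsYOfRecordV1 (N : ℕ) (θ : Stage3Params) (Mstar : ℕ) (𝔯 : ResY N θ Mstar) (𝔈₀ : ExpsY N θ Mstar)
    [∀ x : MemberY θ.d₆ θ.ℓ₆ θ.hd' θ.hL' θ.b₀ θ.b₁ Mstar, Fintype (geo9Y x).Site]
    [∀ x : MemberY θ.d₆ θ.ℓ₆ θ.hd' θ.hL' θ.b₀ θ.b₁ Mstar, DecidableEq (geo9Y x).Site]
    (bI : ∀ x : MemberY θ.d₆ θ.ℓ₆ θ.hd' θ.hL' θ.b₀ θ.b₁ Mstar, FBondY x.toKIdx → IBondY x.toKIdx) (α' r39 B39 : ℝ) (p q : PinPrims)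
    (p3 q3 : PairPrims) (pM qM : MixedPrims) (H : MemberY θ.d₆ θ.ℓ₆ θ.hd' θ.hL' θ.b₀ θ.b₁ Mstar → Prop)
    (𝔬 : ∀ x : MemberY θ.d₆ θ.ℓ₆ θ.hd' θ.hL' θ.b₀ θ.b₁ Mstar, Ops (geo9Y x) (bg9Y (Matrix (Fin N) (Fin N) ℂ) (specialUnitaryUnits (Fin N)) x)
      (XSK (TrIdx N) x.toKIdx) (XSK (TrIdx N) x.toKIdx) ↥(cubes x.toKIdx.D.toDomains))
    (𝔡 : ∀ x : MemberY θ.d₆ θ.ℓ₆ θ.hd' θ.hL' θ.b₀ θ.b₁ Mstar, DirOps37 (𝔬 x) (Fin (θ.d₆ + 1)))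
    (𝔩 : ∀ x : MemberY θ.d₆ θ.ℓ₆ θ.hd' θ.hL' θ.b₀ θ.b₁ Mstar, DirLetters37 (𝔬 x) (Fin (θ.d₆ + 1)))
    (rd : ∀ x : MemberY θ.d₆ θ.ℓ₆ θ.hd' θ.hL' θ.b₀ θ.b₁ Mstar, WalkReading (geo9Y x) (bg9Y (Matrix (Fin N) (Fin N) ℂ) (specialUnitaryUnits (Fin N)) x)
      (XSK (TrIdx N) x.toKIdx) ↥(cubes x.toKIdx.D.toDomains))
    {ιA AA : MemberY θ.d₆ θ.ℓ₆ θ.hd' θ.hL' θ.b₀ θ.b₁ Mstar → Type} [∀ x, Fintype (ιA x)] [∀ x, Fintype (AA x)]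
    (𝔬A : ∀ x : MemberY θ.d₆ θ.ℓ₆ θ.hd' θ.hL' θ.b₀ θ.b₁ Mstar, Ops310 (geo9Y x) (bg9Y (Matrix (Fin N) (Fin N) ℂ) (specialUnitaryUnits (Fin N)) x)
      (XBK (TrIdx N) x.toKIdx) (XBK (TrIdx N) x.toKIdx) (ιA x) (AA x))
    (rdA : ∀ x : MemberY θ.d₆ θ.ℓ₆ θ.hd' θ.hL' θ.b₀ θ.b₁ Mstar, WalkReading310 (geo9Y x) (bg9Y (Matrix (Fin N) (Fin N) ℂ) (specialUnitaryUnits (Fin N)) x)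
      (XBK (TrIdx N) x.toKIdx) (ιA x) (AA x))
    (𝔬12 : ∀ x : MemberY θ.d₆ θ.ℓ₆ θ.hd' θ.hL' θ.b₀ θ.b₁ Mstar, B9Thm312Whole.Ops (geo9Y x) (bg9Y (Matrix (Fin N) (Fin N) ℂ) (specialUnitaryUnits (Fin N)) x)
      (XBK (TrIdx N) x.toKIdx) (XBK (TrIdx N) x.toKIdx) (XHK (TrIdx N) x.toKIdx) (XSK (TrIdx N) x.toKIdx)) :
    ExpsY N θ Mstar := fun x =>
  { 𝔈₀ x with
    EK39 := EK39OfOpsBlkVia (oneCubeOps39YF θ Mstar (lettersYOfRecordV4P N θ Mstar 𝔯) bI x) (oneCubeReading39 _) (θ.d₆ + 1)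
      (2 * (1 * B39) * rowConst261 (geo9Y (d := θ.d₆) (ℓ := θ.ℓ₆) (hd := θ.hd') (hL := θ.hL') (b₀ := θ.b₀) (b₁ := θ.b₁) (Mstar := Mstar)) (α' * r39))
      ((1 - α') * r39) (repSite39F x.toKIdx (bI x))
    PosDef := PosDefOfOps (ops311Y x (lettersYOfRecordV4P N θ Mstar 𝔯 x) (proofLettersGA (lettersYOfRecordV4P N θ Mstar 𝔯 x)))
    E37 := E37YPairMDir (bg := bg9Y (Matrix (Fin N) (Fin N) ℂ) (specialUnitaryUnits (Fin N))) (2 * (θ.d₆ + 1)) (nbrCountY θ.d₆ θ.ℓ₆ θ.hd' θ.hL' θ.b₀ θ.b₁ 2)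
      (Real.sqrt ((θ.d₆ + 1) * Fintype.card (TrIdx N))) ((θ.d₆ + 1 : ℕ) : ℝ) p q (⟨p3.N3, 2 * p3.B3, 0⟩ : PairPrims) (⟨q3.N3, 2 * q3.B3, 0⟩ : PairPrims) pM qM
      (𝔬 x) (𝔡 x) (𝔩 x) (rd x) (H x)
      (kernelFamilyS x.toKIdx (bg9Y (Matrix (Fin N) (Fin N) ℂ) (specialUnitaryUnits (Fin N)) x) (fun U => U) (lettersYOfRecordV4P N θ Mstar 𝔯 x).Gp
        (lettersYOfRecordV4P N θ Mstar 𝔯 x).parS)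
    E310 := E310YPairM (bg := bg9Y (Matrix (Fin N) (Fin N) ℂ) (specialUnitaryUnits (Fin N))) (2 * (θ.d₆ + 1)) (nbrCountY θ.d₆ θ.ℓ₆ θ.hd' θ.hL' θ.b₀ θ.b₁ 2)
      (Real.sqrt ((θ.d₆ + 1) * Fintype.card (TrIdx N))) ((θ.d₆ + 1 : ℕ) : ℝ) p q (⟨p3.N3, 2 * p3.B3, 0⟩ : PairPrims) (⟨q3.N3, 2 * q3.B3, 0⟩ : PairPrims) pM qM
      (𝔬A x) (rdA x) (H x)
      (kernelFamilyB x.toKIdx (bg9Y (Matrix (Fin N) (Fin N) ℂ) (specialUnitaryUnits (Fin N)) x) (fun U => U) (lettersYOfRecordV4P N θ Mstar 𝔯 x).GA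
        (lettersYOfRecordV4P N θ Mstar 𝔯 x).parB)
    HasRWExp := HasRWExpOfOps (𝔬12 x)
    HasRWExpH := HasRWExpHOfOps (𝔬12 x)
    PosDefK := PosDefKOfOps (𝔬12 x) }

end Defn

section Faces

variable (N : ℕ) (θ : Stage3Params) (Mstar : ℕ) (𝔯 : ResY N θ Mstar) (𝔈₀ : ExpsY N θ Mstar)
  [∀ x : MemberY θ.d₆ θ.ℓ₆ θ.hd' θ.hL' θ.b₀ θ.b₁ Mstar, Fintype (geo9Y x).Site]
  [∀ x : MemberY θ.d₆ θ.ℓ₆ θ.hd' θ.hL' θ.b₀ θ.b₁ Mstar, DecidableEq (geo9Y x).Site]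
  (bI : ∀ x : MemberY θ.d₆ θ.ℓ₆ θ.hd' θ.hL' θ.b₀ θ.b₁ Mstar, FBondY x.toKIdx → IBondY x.toKIdx) (α' r39 B39 : ℝ) (p q : PinPrims)
  (p3 q3 : PairPrims) (pM qM : MixedPrims) (H : MemberY θ.d₆ θ.ℓ₆ θ.hd' θ.hL' θ.b₀ θ.b₁ Mstar → Prop)
  (𝔬 : ∀ x : MemberY θ.d₆ θ.ℓ₆ θ.hd' θ.hL' θ.b₀ θ.b₁ Mstar, Ops (geo9Y x) (bg9Y (Matrix (Fin N) (Fin N) ℂ) (specialUnitaryUnits (Fin N)) x)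
    (XSK (TrIdx N) x.toKIdx) (XSK (TrIdx N) x.toKIdx) ↥(cubes x.toKIdx.D.toDomains))
  (𝔡 : ∀ x : MemberY θ.d₆ θ.ℓ₆ θ.hd' θ.hL' θ.b₀ θ.b₁ Mstar, DirOps37 (𝔬 x) (Fin (θ.d₆ + 1)))
  (𝔩 : ∀ x : MemberY θ.d₆ θ.ℓ₆ θ.hd' θ.hL' θ.b₀ θ.b₁ Mstar, DirLetters37 (𝔬 x) (Fin (θ.d₆ + 1)))
  (rd : ∀ x : MemberY θ.d₆ θ.ℓ₆ θ.hd' θ.hL' θ.b₀ θ.b₁ Mstar, WalkReading (geo9Y x) (bg9Y (Matrix (Fin N) (Fin N) ℂ) (specialUnitaryUnits (Fin N)) x)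
    (XSK (TrIdx N) x.toKIdx) ↥(cubes x.toKIdx.D.toDomains))
  {ιA AA : MemberY θ.d₆ θ.ℓ₆ θ.hd' θ.hL' θ.b₀ θ.b₁ Mstar → Type} [∀ x, Fintype (ιA x)] [∀ x, Fintype (AA x)]
  (𝔬A : ∀ x : MemberY θ.d₆ θ.ℓ₆ θ.hd' θ.hL' θ.b₀ θ.b₁ Mstar, Ops310 (geo9Y x) (bg9Y (Matrix (Fin N) (Fin N) ℂ) (specialUnitaryUnits (Fin N)) x)
    (XBK (TrIdx N) x.toKIdx) (XBK (TrIdx N) x.toKIdx) (ιA x) (AA x))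
  (rdA : ∀ x : MemberY θ.d₆ θ.ℓ₆ θ.hd' θ.hL' θ.b₀ θ.b₁ Mstar, WalkReading310 (geo9Y x) (bg9Y (Matrix (Fin N) (Fin N) ℂ) (specialUnitaryUnits (Fin N)) x)
    (XBK (TrIdx N) x.toKIdx) (ιA x) (AA x))
  (𝔬12 : ∀ x : MemberY θ.d₆ θ.ℓ₆ θ.hd' θ.hL' θ.b₀ θ.b₁ Mstar, B9Thm312Whole.Ops (geo9Y x) (bg9Y (Matrix (Fin N) (Fin N) ℂ) (specialUnitaryUnits (Fin N)) x)
    (XBK (TrIdx N) x.toKIdx) (XBK (TrIdx N) x.toKIdx) (XHK (TrIdx N) x.toKIdx) (XSK (TrIdx N) x.toKIdx))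

/-- the three fields KEPT from the base record: the analyticity predicate (row 13's fourth slot; Sect.-B content) and the two Sect.-E predicates.
[cite: Balaban1985BackgroundPropagators, (3.69)–(3.70) p.404, Thm 3.15 (3.185)–(3.187) p.432, bookkeeping] -/
theorem expsYOfRecordV1_kept (x : MemberY θ.d₆ θ.ℓ₆ θ.hd' θ.hL' θ.b₀ θ.b₁ Mstar) :
    (expsYOfRecordV1 N θ Mstar 𝔯 𝔈₀ bI α' r39 B39 p q p3 q3 pM qM H 𝔬 𝔡 𝔩 rd 𝔬A rdA 𝔬12 x).IsAnalyticExt = (𝔈₀ x).IsAnalyticExt ∧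
      (expsYOfRecordV1 N θ Mstar 𝔯 𝔈₀ bI α' r39 B39 p q p3 q3 pM qM H 𝔬 𝔡 𝔩 rd 𝔬A rdA 𝔬12 x).GivenBy3185 = (𝔈₀ x).GivenBy3185 ∧
      (expsYOfRecordV1 N θ Mstar 𝔯 𝔈₀ bI α' r39 B39 p q p3 q3 pM qM H 𝔬 𝔡 𝔩 rd 𝔬A rdA 𝔬12 x).HasRWExpC = (𝔈₀ x).HasRWExpC := ⟨rfl, rfl, rfl⟩

/-- the record at a base that already IS a record of record is itself (the seven replaced fields do not read `𝔈₀`). [cite: Balaban1985BackgroundPropagators, Thms 3.7–3.13 pp.409–426, bookkeeping] -/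
theorem expsYOfRecordV1_idem :
    expsYOfRecordV1 N θ Mstar 𝔯 (expsYOfRecordV1 N θ Mstar 𝔯 𝔈₀ bI α' r39 B39 p q p3 q3 pM qM H 𝔬 𝔡 𝔩 rd 𝔬A rdA 𝔬12) bI α' r39 B39 p q p3 q3 pM qM H 𝔬 𝔡 𝔩 rd
        𝔬A rdA 𝔬12 =
      expsYOfRecordV1 N θ Mstar 𝔯 𝔈₀ bI α' r39 B39 p q p3 q3 pM qM H 𝔬 𝔡 𝔩 rd 𝔬A rdA 𝔬12 := rfl

/-- the three Theorem-3.12∕3.13 fields ARE the `…OfOps` predicates of the Sect.-D letters. [cite: Balaban1985BackgroundPropagators, Thm 3.12 p.423, Thm 3.13 p.426, bookkeeping] -/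
theorem expsYOfRecordV1_sectD (x : MemberY θ.d₆ θ.ℓ₆ θ.hd' θ.hL' θ.b₀ θ.b₁ Mstar) :
    (expsYOfRecordV1 N θ Mstar 𝔯 𝔈₀ bI α' r39 B39 p q p3 q3 pM qM H 𝔬 𝔡 𝔩 rd 𝔬A rdA 𝔬12 x).HasRWExp = HasRWExpOfOps (𝔬12 x) ∧
      (expsYOfRecordV1 N θ Mstar 𝔯 𝔈₀ bI α' r39 B39 p q p3 q3 pM qM H 𝔬 𝔡 𝔩 rd 𝔬A rdA 𝔬12 x).HasRWExpH = HasRWExpHOfOps (𝔬12 x) ∧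
      (expsYOfRecordV1 N θ Mstar 𝔯 𝔈₀ bI α' r39 B39 p q p3 q3 pM qM H 𝔬 𝔡 𝔩 rd 𝔬A rdA 𝔬12 x).PosDefK = PosDefKOfOps (𝔬12 x) := ⟨rfl, rfl, rfl⟩

/-- the Theorem-3.11 field IS `PosDefOfOps` at the letters of record with the trivial parametrix proof letters. [cite: Balaban1985BackgroundPropagators, Thm 3.11 p.416, bookkeeping] -/
theorem expsYOfRecordV1_posDef (x : MemberY θ.d₆ θ.ℓ₆ θ.hd' θ.hL' θ.b₀ θ.b₁ Mstar) :
    (expsYOfRecordV1 N θ Mstar 𝔯 𝔈₀ bI α' r39 B39 p q p3 q3 pM qM H 𝔬 𝔡 𝔩 rd 𝔬A rdA 𝔬12 x).PosDef =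
      PosDefOfOps (ops311Y x (lettersYOfRecordV4P N θ Mstar 𝔯 x) (proofLettersGA (lettersYOfRecordV4P N θ Mstar 𝔯 x))) := rfl

/-! ## §2 ★★ The seven faces at the instances of record, in the certificate's binder shapes -/

variable (𝔢 : SectEY N θ Mstar) (𝔴 : RWEY N θ Mstar)

/-- ★ `hEK39` at the `ν`-read instance of record fed `expsYOfRecordV1`. [cite: Balaban1985BackgroundPropagators, Thm 3.9 (3.98)–(3.99) p.413 + Thm 3.2 (3.48) p.398, bookkeeping] -/
theorem pinEK39 (x : MemberY θ.d₆ θ.ℓ₆ θ.hd' θ.hL' θ.b₀ θ.b₁ Mstar) :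
    ((opsYNuOfRecordV4PE N θ Mstar 𝔯 𝔢 𝔴 (expsYOfRecordV1 N θ Mstar 𝔯 𝔈₀ bI α' r39 B39 p q p3 q3 pM qM H 𝔬 𝔡 𝔩 rd 𝔬A rdA 𝔬12)) x).EK39 =
      EK39OfOpsBlkVia (oneCubeOps39YF θ Mstar (lettersYOfRecordV4P N θ Mstar 𝔯) bI x) (oneCubeReading39 _) (θ.d₆ + 1)
        (2 * (1 * B39) * rowConst261 (geo9Y (d := θ.d₆) (ℓ := θ.ℓ₆) (hd := θ.hd') (hL := θ.hL') (b₀ := θ.b₀) (b₁ := θ.b₁) (Mstar := Mstar)) (α' * r39))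
        ((1 - α') * r39) (repSite39F x.toKIdx (bI x)) := rfl

/-- ★ `hPD` at the `ν`-read instance of record fed `expsYOfRecordV1`. [cite: Balaban1985BackgroundPropagators, Thm 3.11 p.416, bookkeeping] -/
theorem pinPosDef (x : MemberY θ.d₆ θ.ℓ₆ θ.hd' θ.hL' θ.b₀ θ.b₁ Mstar) :
    ((opsYNuOfRecordV4PE N θ Mstar 𝔯 𝔢 𝔴 (expsYOfRecordV1 N θ Mstar 𝔯 𝔈₀ bI α' r39 B39 p q p3 q3 pM qM H 𝔬 𝔡 𝔩 rd 𝔬A rdA 𝔬12)) x).PosDef =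
      PosDefOfOps (ops311Y x (lettersYOfRecordV4P N θ Mstar 𝔯 x) (proofLettersGA (lettersYOfRecordV4P N θ Mstar 𝔯 x))) := rfl

/-- ★ `hE37` at the `ν`-read instance of record fed `expsYOfRecordV1` — the site kernel family on the right is the instance's OWN `.Gp`.
[cite: Balaban1985BackgroundPropagators, Thm 3.7 (3.90) p.409 + Cor. 3.8 (3.93)–(3.94) p.410, bookkeeping] -/
theorem pinE37 (x : MemberY θ.d₆ θ.ℓ₆ θ.hd' θ.hL' θ.b₀ θ.b₁ Mstar) :
    ((opsYNuOfRecordV4PE N θ Mstar 𝔯 𝔢 𝔴 (expsYOfRecordV1 N θ Mstar 𝔯 𝔈₀ bI α' r39 B39 p q p3 q3 pM qM H 𝔬 𝔡 𝔩 rd 𝔬A rdA 𝔬12)) x).E37 =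
      E37YPairMDir (bg := bg9Y (Matrix (Fin N) (Fin N) ℂ) (specialUnitaryUnits (Fin N))) (2 * (θ.d₆ + 1)) (nbrCountY θ.d₆ θ.ℓ₆ θ.hd' θ.hL' θ.b₀ θ.b₁ 2)
        (Real.sqrt ((θ.d₆ + 1) * Fintype.card (TrIdx N))) ((θ.d₆ + 1 : ℕ) : ℝ) p q (⟨p3.N3, 2 * p3.B3, 0⟩ : PairPrims) (⟨q3.N3, 2 * q3.B3, 0⟩ : PairPrims)
        pM qM (𝔬 x) (𝔡 x) (𝔩 x) (rd x) (H x)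
        ((opsYNuOfRecordV4PE N θ Mstar 𝔯 𝔢 𝔴 (expsYOfRecordV1 N θ Mstar 𝔯 𝔈₀ bI α' r39 B39 p q p3 q3 pM qM H 𝔬 𝔡 𝔩 rd 𝔬A rdA 𝔬12)) x).Gp := rfl

/-- ★ `hE310` at the `ν`-read instance of record fed `expsYOfRecordV1` — the bond kernel family on the right is the instance's OWN `.GA`.
[cite: Balaban1985BackgroundPropagators, Thm 3.10 (3.107)–(3.108) pp.415–416, bookkeeping] -/
theorem pinE310 (x : MemberY θ.d₆ θ.ℓ₆ θ.hd' θ.hL' θ.b₀ θ.b₁ Mstar) :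
    ((opsYNuOfRecordV4PE N θ Mstar 𝔯 𝔢 𝔴 (expsYOfRecordV1 N θ Mstar 𝔯 𝔈₀ bI α' r39 B39 p q p3 q3 pM qM H 𝔬 𝔡 𝔩 rd 𝔬A rdA 𝔬12)) x).E310 =
      E310YPairM (bg := bg9Y (Matrix (Fin N) (Fin N) ℂ) (specialUnitaryUnits (Fin N))) (2 * (θ.d₆ + 1)) (nbrCountY θ.d₆ θ.ℓ₆ θ.hd' θ.hL' θ.b₀ θ.b₁ 2)
        (Real.sqrt ((θ.d₆ + 1) * Fintype.card (TrIdx N))) ((θ.d₆ + 1 : ℕ) : ℝ) p q (⟨p3.N3, 2 * p3.B3, 0⟩ : PairPrims) (⟨q3.N3, 2 * q3.B3, 0⟩ : PairPrims)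
        pM qM (𝔬A x) (rdA x) (H x)
        ((opsYNuOfRecordV4PE N θ Mstar 𝔯 𝔢 𝔴 (expsYOfRecordV1 N θ Mstar 𝔯 𝔈₀ bI α' r39 B39 p q p3 q3 pM qM H 𝔬 𝔡 𝔩 rd 𝔬A rdA 𝔬12)) x).GA := rfl

/-- ★ `hpinE ∕ hpinH ∕ hpinK` at the `ν`-read instance of record fed `expsYOfRecordV1`. [cite: Balaban1985BackgroundPropagators, Thm 3.12 p.423, Thm 3.13 p.426, bookkeeping] -/
theorem pinSectD (x : MemberY θ.d₆ θ.ℓ₆ θ.hd' θ.hL' θ.b₀ θ.b₁ Mstar) :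
    ((opsYNuOfRecordV4PE N θ Mstar 𝔯 𝔢 𝔴 (expsYOfRecordV1 N θ Mstar 𝔯 𝔈₀ bI α' r39 B39 p q p3 q3 pM qM H 𝔬 𝔡 𝔩 rd 𝔬A rdA 𝔬12)) x).HasRWExp =
        HasRWExpOfOps (𝔬12 x) ∧
      ((opsYNuOfRecordV4PE N θ Mstar 𝔯 𝔢 𝔴 (expsYOfRecordV1 N θ Mstar 𝔯 𝔈₀ bI α' r39 B39 p q p3 q3 pM qM H 𝔬 𝔡 𝔩 rd 𝔬A rdA 𝔬12)) x).HasRWExpH =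
        HasRWExpHOfOps (𝔬12 x) ∧
      ((opsYNuOfRecordV4PE N θ Mstar 𝔯 𝔢 𝔴 (expsYOfRecordV1 N θ Mstar 𝔯 𝔈₀ bI α' r39 B39 p q p3 q3 pM qM H 𝔬 𝔡 𝔩 rd 𝔬A rdA 𝔬12)) x).PosDefK =
        PosDefKOfOps (𝔬12 x) := ⟨rfl, rfl, rfl⟩

/-- the analyticity predicate of the `ν`-read instance of record fed `expsYOfRecordV1` is STILL the base record's (free). [cite: Balaban1985BackgroundPropagators, (3.69)–(3.70) p.404, bookkeeping] -/
theorem isAnalyticExt_eq (x : MemberY θ.d₆ θ.ℓ₆ θ.hd' θ.hL' θ.b₀ θ.b₁ Mstar) :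
    ((opsYNuOfRecordV4PE N θ Mstar 𝔯 𝔢 𝔴 (expsYOfRecordV1 N θ Mstar 𝔯 𝔈₀ bI α' r39 B39 p q p3 q3 pM qM H 𝔬 𝔡 𝔩 rd 𝔬A rdA 𝔬12)) x).IsAnalyticExt =
      (𝔈₀ x).IsAnalyticExt := rfl

variable {N θ Mstar 𝔯 𝔈₀ bI α' r39 B39 p q p3 q3 pM qM H 𝔬 𝔡 𝔩 rd 𝔬A rdA 𝔬12 𝔢 𝔴}

/-- ★★★ **THE SEVEN PINS FROM ONE EQUATION** at the `ν`-read instance of record: if the certificate's `𝔈` IS `expsYOfRecordV1 …`, the displayed binders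
`hEK39 ∕ hPD ∕ hE37 ∕ hE310 ∕ hpinE ∕ hpinH ∕ hpinK` of edition 41 hold, in exactly their shapes (obtain them with one `obtain ⟨…⟩`).
[cite: Balaban1985BackgroundPropagators, Thm 3.7 (3.90) p.409, Thm 3.9 (3.98)–(3.99) p.413, Thm 3.10 (3.107)–(3.108) pp.415–416, Thm 3.11 p.416, Thm 3.12 p.423,
Thm 3.13 p.426, bookkeeping] -/
theorem pins_of_eq {𝔈 : ExpsY N θ Mstar}
    (h𝔈 : 𝔈 = expsYOfRecordV1 N θ Mstar 𝔯 𝔈₀ bI α' r39 B39 p q p3 q3 pM qM H 𝔬 𝔡 𝔩 rd 𝔬A rdA 𝔬12) :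
    (∀ x : MemberY θ.d₆ θ.ℓ₆ θ.hd' θ.hL' θ.b₀ θ.b₁ Mstar, ((opsYNuOfRecordV4PE N θ Mstar 𝔯 𝔢 𝔴 𝔈) x).EK39 =
        EK39OfOpsBlkVia (oneCubeOps39YF θ Mstar (lettersYOfRecordV4P N θ Mstar 𝔯) bI x) (oneCubeReading39 _) (θ.d₆ + 1)
          (2 * (1 * B39) * rowConst261 (geo9Y (d := θ.d₆) (ℓ := θ.ℓ₆) (hd := θ.hd') (hL := θ.hL') (b₀ := θ.b₀) (b₁ := θ.b₁) (Mstar := Mstar)) (α' * r39))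
          ((1 - α') * r39) (repSite39F x.toKIdx (bI x))) ∧
      (∀ x : MemberY θ.d₆ θ.ℓ₆ θ.hd' θ.hL' θ.b₀ θ.b₁ Mstar, ((opsYNuOfRecordV4PE N θ Mstar 𝔯 𝔢 𝔴 𝔈) x).PosDef =
        PosDefOfOps (ops311Y x (lettersYOfRecordV4P N θ Mstar 𝔯 x) (proofLettersGA (lettersYOfRecordV4P N θ Mstar 𝔯 x)))) ∧
      (∀ x : MemberY θ.d₆ θ.ℓ₆ θ.hd' θ.hL' θ.b₀ θ.b₁ Mstar, ((opsYNuOfRecordV4PE N θ Mstar 𝔯 𝔢 𝔴 𝔈) x).E37 =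
        E37YPairMDir (bg := bg9Y (Matrix (Fin N) (Fin N) ℂ) (specialUnitaryUnits (Fin N))) (2 * (θ.d₆ + 1)) (nbrCountY θ.d₆ θ.ℓ₆ θ.hd' θ.hL' θ.b₀ θ.b₁ 2)
          (Real.sqrt ((θ.d₆ + 1) * Fintype.card (TrIdx N))) ((θ.d₆ + 1 : ℕ) : ℝ) p q (⟨p3.N3, 2 * p3.B3, 0⟩ : PairPrims) (⟨q3.N3, 2 * q3.B3, 0⟩ : PairPrims)
          pM qM (𝔬 x) (𝔡 x) (𝔩 x) (rd x) (H x) ((opsYNuOfRecordV4PE N θ Mstar 𝔯 𝔢 𝔴 𝔈) x).Gp) ∧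
      (∀ x : MemberY θ.d₆ θ.ℓ₆ θ.hd' θ.hL' θ.b₀ θ.b₁ Mstar, ((opsYNuOfRecordV4PE N θ Mstar 𝔯 𝔢 𝔴 𝔈) x).E310 =
        E310YPairM (bg := bg9Y (Matrix (Fin N) (Fin N) ℂ) (specialUnitaryUnits (Fin N))) (2 * (θ.d₆ + 1)) (nbrCountY θ.d₆ θ.ℓ₆ θ.hd' θ.hL' θ.b₀ θ.b₁ 2)
          (Real.sqrt ((θ.d₆ + 1) * Fintype.card (TrIdx N))) ((θ.d₆ + 1 : ℕ) : ℝ) p q (⟨p3.N3, 2 * p3.B3, 0⟩ : PairPrims) (⟨q3.N3, 2 * q3.B3, 0⟩ : PairPrims)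
          pM qM (𝔬A x) (rdA x) (H x) ((opsYNuOfRecordV4PE N θ Mstar 𝔯 𝔢 𝔴 𝔈) x).GA) ∧
      (∀ x : MemberY θ.d₆ θ.ℓ₆ θ.hd' θ.hL' θ.b₀ θ.b₁ Mstar, ((opsYNuOfRecordV4PE N θ Mstar 𝔯 𝔢 𝔴 𝔈) x).HasRWExp = HasRWExpOfOps (𝔬12 x)) ∧
      (∀ x : MemberY θ.d₆ θ.ℓ₆ θ.hd' θ.hL' θ.b₀ θ.b₁ Mstar, ((opsYNuOfRecordV4PE N θ Mstar 𝔯 𝔢 𝔴 𝔈) x).HasRWExpH = HasRWExpHOfOps (𝔬12 x)) ∧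
      (∀ x : MemberY θ.d₆ θ.ℓ₆ θ.hd' θ.hL' θ.b₀ θ.b₁ Mstar, ((opsYNuOfRecordV4PE N θ Mstar 𝔯 𝔢 𝔴 𝔈) x).PosDefK = PosDefKOfOps (𝔬12 x)) := by
  subst h𝔈; exact ⟨fun _ => rfl, fun _ => rfl, fun _ => rfl, fun _ => rfl, fun _ => rfl, fun _ => rfl, fun _ => rfl⟩

/-- ★★ the same seven pins at the PLAIN v4P instance of record `opsYOfRecordV4PE` (def-Y's v6 ∕ v7 records are its instances).
[cite: Balaban1985BackgroundPropagators, Thm 3.7 (3.90) p.409, Thm 3.9 (3.98)–(3.99) p.413, Thm 3.10 (3.107)–(3.108) pp.415–416, Thm 3.11 p.416, Thm 3.12 p.423,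
Thm 3.13 p.426, bookkeeping] -/
theorem pinsP_of_eq {𝔈 : ExpsY N θ Mstar}
    (h𝔈 : 𝔈 = expsYOfRecordV1 N θ Mstar 𝔯 𝔈₀ bI α' r39 B39 p q p3 q3 pM qM H 𝔬 𝔡 𝔩 rd 𝔬A rdA 𝔬12) :
    (∀ x : MemberY θ.d₆ θ.ℓ₆ θ.hd' θ.hL' θ.b₀ θ.b₁ Mstar, ((opsYOfRecordV4PE N θ Mstar 𝔯 𝔢 𝔴 𝔈) x).EK39 =
        EK39OfOpsBlkVia (oneCubeOps39YF θ Mstar (lettersYOfRecordV4P N θ Mstar 𝔯) bI x) (oneCubeReading39 _) (θ.d₆ + 1)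
          (2 * (1 * B39) * rowConst261 (geo9Y (d := θ.d₆) (ℓ := θ.ℓ₆) (hd := θ.hd') (hL := θ.hL') (b₀ := θ.b₀) (b₁ := θ.b₁) (Mstar := Mstar)) (α' * r39))
          ((1 - α') * r39) (repSite39F x.toKIdx (bI x))) ∧
      (∀ x : MemberY θ.d₆ θ.ℓ₆ θ.hd' θ.hL' θ.b₀ θ.b₁ Mstar, ((opsYOfRecordV4PE N θ Mstar 𝔯 𝔢 𝔴 𝔈) x).PosDef =
        PosDefOfOps (ops311Y x (lettersYOfRecordV4P N θ Mstar 𝔯 x) (proofLettersGA (lettersYOfRecordV4P N θ Mstar 𝔯 x)))) ∧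
      (∀ x : MemberY θ.d₆ θ.ℓ₆ θ.hd' θ.hL' θ.b₀ θ.b₁ Mstar, ((opsYOfRecordV4PE N θ Mstar 𝔯 𝔢 𝔴 𝔈) x).E37 =
        E37YPairMDir (bg := bg9Y (Matrix (Fin N) (Fin N) ℂ) (specialUnitaryUnits (Fin N))) (2 * (θ.d₆ + 1)) (nbrCountY θ.d₆ θ.ℓ₆ θ.hd' θ.hL' θ.b₀ θ.b₁ 2)
          (Real.sqrt ((θ.d₆ + 1) * Fintype.card (TrIdx N))) ((θ.d₆ + 1 : ℕ) : ℝ) p q (⟨p3.N3, 2 * p3.B3, 0⟩ : PairPrims) (⟨q3.N3, 2 * q3.B3, 0⟩ : PairPrims)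
          pM qM (𝔬 x) (𝔡 x) (𝔩 x) (rd x) (H x) ((opsYOfRecordV4PE N θ Mstar 𝔯 𝔢 𝔴 𝔈) x).Gp) ∧
      (∀ x : MemberY θ.d₆ θ.ℓ₆ θ.hd' θ.hL' θ.b₀ θ.b₁ Mstar, ((opsYOfRecordV4PE N θ Mstar 𝔯 𝔢 𝔴 𝔈) x).E310 =
        E310YPairM (bg := bg9Y (Matrix (Fin N) (Fin N) ℂ) (specialUnitaryUnits (Fin N))) (2 * (θ.d₆ + 1)) (nbrCountY θ.d₆ θ.ℓ₆ θ.hd' θ.hL' θ.b₀ θ.b₁ 2)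
          (Real.sqrt ((θ.d₆ + 1) * Fintype.card (TrIdx N))) ((θ.d₆ + 1 : ℕ) : ℝ) p q (⟨p3.N3, 2 * p3.B3, 0⟩ : PairPrims) (⟨q3.N3, 2 * q3.B3, 0⟩ : PairPrims)
          pM qM (𝔬A x) (rdA x) (H x) ((opsYOfRecordV4PE N θ Mstar 𝔯 𝔢 𝔴 𝔈) x).GA) ∧
      (∀ x : MemberY θ.d₆ θ.ℓ₆ θ.hd' θ.hL' θ.b₀ θ.b₁ Mstar, ((opsYOfRecordV4PE N θ Mstar 𝔯 𝔢 𝔴 𝔈) x).HasRWExp = HasRWExpOfOps (𝔬12 x)) ∧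
      (∀ x : MemberY θ.d₆ θ.ℓ₆ θ.hd' θ.hL' θ.b₀ θ.b₁ Mstar, ((opsYOfRecordV4PE N θ Mstar 𝔯 𝔢 𝔴 𝔈) x).HasRWExpH = HasRWExpHOfOps (𝔬12 x)) ∧
      (∀ x : MemberY θ.d₆ θ.ℓ₆ θ.hd' θ.hL' θ.b₀ θ.b₁ Mstar, ((opsYOfRecordV4PE N θ Mstar 𝔯 𝔢 𝔴 𝔈) x).PosDefK = PosDefKOfOps (𝔬12 x)) := by
  subst h𝔈; exact ⟨fun _ => rfl, fun _ => rfl, fun _ => rfl, fun _ => rfl, fun _ => rfl, fun _ => rfl, fun _ => rfl⟩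

end Faces

end Literature.MathematicalPhysics.QuantumFieldTheory.Balaban1983to89.Node00.OpsYExpsOfRecord

end
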